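import Summits.QuantumFields.YangMills.Theses.ForcedResponseSkewness
import Summits.QuantumFields.YangMills.Theorems.ForcedResponseSkewnessRunningCouplingCeilingOfMomentBounds6Body
import HarnessLib

/-!
# Crux `RunningCouplingCeiling` (repaired: stmt-QuantumFields-24275) BY NAME from `MomentBounds6` ∧ the LOCAL log-decay clause

Support file (`--supports stmt-QuantumFields-24275 --as helper`) by the width prover `ym-line-frs-p3` (g2) of route
`ForcedResponseSkewness` (lead `ym-line-frs-p1`): the named one-liner over the route-independent body
`runningCouplingCeilingBody_of_momentBounds6_of_localLogDecay` (`…RunningCouplingCeilingOfMomentBounds6Body`):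

* `runningCouplingCeiling_of_momentBounds6_of_localLogDecay` — for every compact simple `G`, `r`, unit map `a → 0⁺` with the
  repaired pinning clause: (UV) `MomentBounds6 G r a` (spine UV leg in that unit) and (AF) the LOCAL log-decay clause
  `n₀ ≤ d → a(β) d ≤ ½ → d⁸|torusCov β L x y| ≤ C₀/log²(1/(a(β) d))` on large tori ⟹ `RunningCouplingCeiling`.  So the physics
  debt of 24275 is femto/UV ∧ AF, with NO clause at unbounded physical separation (contrast the registered `PointwiseSigR`).

Honest label: a CONDITIONAL reduction inside a conditional rung line (leaf R2a `BalabanLadder.NT`); (UV) and (AF) are NOT proved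
here, no stub of 24275 is closed; nothing here bears on the Yang–Mills mass gap, which is NOT proved by any of this.
-/

set_option autoImplicit false

noncomputable section

namespace Summit.QuantumFields.YangMills.Cruxes.RunningCouplingCeiling.Pointwise

open scoped SchwartzMap
open MeasureTheory Filter Topology
open Literature.MathematicalPhysics.QuantumFieldTheory Literature.MathematicalPhysics.QuantumLattice
open Literature.Probability.LatticeModels
open Summit.QuantumFields.YangMills.Cruxes.OSLegsFromFemtoAndGap.DlrCollarTransfer
open Summit.QuantumFields.YangMills.Theses.ForcedResponseSkewness

/-- **`RunningCouplingCeiling` ⇐ `MomentBounds6` (spine UV leg, in the pinned unit) ∧ the LOCAL log-decay clause** — the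
repaired crux stmt-QuantumFields-24275 BY NAME (body: `runningCouplingCeilingBody_of_momentBounds6_of_localLogDecay`).
[folklore] -/
theorem runningCouplingCeiling_of_momentBounds6_of_localLogDecay
    (hMB : ∀ (G : Type) [Group G] [TopologicalSpace G] [IsTopologicalGroup G] [CompactSpace G],
      IsCompactSimpleLieGroup G →
      letI : MeasurableSpace G := borel G
      haveI : BorelSpace G := ⟨rfl⟩
      ∀ (r : LatticeRep G) (a : ℝ → ℝ), (∀ β, 0 < a β) → Filter.Tendsto a Filter.atTop (nhds 0) →
        (∃ (v₀ : 𝓢(EuclideanSpace ℝ (Fin 4), ℝ)) (ε β₅ Λ₅ : ℝ), HasCompactSupport v₀ ∧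
          tsupport v₀ ⊆ {y : EuclideanSpace ℝ (Fin 4) | 0 < y 0} ∧ 0 < ε ∧
          ∀ β : ℝ, β₅ ≤ β → ∀ L : ℕ, Λ₅ ≤ a β * L → ε ≤ Q2 G r β L (a β) (thetaTest 4 v₀) v₀) →
        MomentBounds6 G r a)
    (hlog : ∀ (G : Type) [Group G] [TopologicalSpace G] [IsTopologicalGroup G] [CompactSpace G],
      IsCompactSimpleLieGroup G →
      letI : MeasurableSpace G := borel G
      haveI : BorelSpace G := ⟨rfl⟩
      ∀ (r : LatticeRep G) (a : ℝ → ℝ), (∀ β, 0 < a β) → Filter.Tendsto a Filter.atTop (nhds 0) →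
        (∃ (v₀ : 𝓢(EuclideanSpace ℝ (Fin 4), ℝ)) (ε β₅ Λ₅ : ℝ), HasCompactSupport v₀ ∧
          tsupport v₀ ⊆ {y : EuclideanSpace ℝ (Fin 4) | 0 < y 0} ∧ 0 < ε ∧
          ∀ β : ℝ, β₅ ≤ β → ∀ L : ℕ, Λ₅ ≤ a β * L → ε ≤ Q2 G r β L (a β) (thetaTest 4 v₀) v₀) →
        ∃ C₀ : ℝ, ∃ n₀ : ℕ, ∃ β₀ Λ₀ : ℝ, ∀ β : ℝ, β₀ ≤ β → ∀ L : ℕ, Λ₀ ≤ a β * L →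
          ∀ x ∈ box 4 L, ∀ y ∈ box 4 L,
            (n₀ : ℝ) ≤ torusDist L x y → a β * torusDist L x y ≤ 1 / 2 →
              torusDist L x y ^ 8 * |torusCov G r β L x y| ≤
                C₀ / Real.log (1 / (a β * torusDist L x y)) ^ 2) :
    RunningCouplingCeiling :=
  runningCouplingCeilingBody_of_momentBounds6_of_localLogDecay hMB hlog

end Summit.QuantumFields.YangMills.Cruxes.RunningCouplingCeiling.Pointwise

end
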